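import Literature.Topology.FourManifolds.SignatureBordismInvariance
import HarnessLib

/-!
# `isOrientedBordant_iff_signature_eq` (spc4.S36) from Thom's Thm IV.13 alone
(Layer 8b of `Literature.Topology.FourManifolds.isOrientedBordant_iff_signature_eq`)

Sibling proof file of `Literature.Topology.FourManifolds.BordismFourLefschetz`,
`Literature.Topology.FourManifolds.BordismFourDuality` and
`Literature.Topology.FourManifolds.SignatureBordismInvariance`.  With Lefschetz duality
(`bijective_relCapProduct_of_isRelFundamentalClass_holds`, `…LefschetzDualityProofs`) and Poincaré
duality (`poincare_duality`, `…PoincareDualityProofs`) theorems of `Literature`, both leaves of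
Thom's Thm IV.1 in dimension four are discharged in the tree — `two_mul_boundaryImageRank_eq_holds`
(Thom 1952, Cor. V.8; `…BordismFourDuality`) and `signature_eq_of_isOrientedBordant_holds`
(Thom 1954, Thm IV.1; `…SignatureBordismInvariance`).  Hence the status of spc4.S36:

* `isOrientedBordant_iff_signature_eq_of_thom` — **`isOrientedBordant_iff_signature_eq` from
  Thom's Thm IV.13 ALONE**: the only remaining input is its converse half
  `h₂ = isOrientedBordant_of_signature_eq` (`Ω⁴ ≅ ℤ`, detected by the signature; Thom 1954,
  Thm IV.13 / Rokhlin 1952).  REMAINING HYPOTHESES: 1.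

No definitions, no named facts.

## References

* R. Thom, *Quelques propriétés globales des variétés différentiables*, Comment. Math. Helv. 28
  (1954), Thm IV.1 (p. 65), Thm IV.13 (p. 81). [ThomCMH1954]
* R. Thom, *Espaces fibrés en sphères et carrés de Steenrod*, Ann. Sci. ENS 69 (1952), Cor. V.8
  (p. 173). [Thom1952]
-/

noncomputable section

open scoped Manifold ContDiff Topology

universe u

namespace Literature.Topology.FourManifolds

section SPC4

/-- **spc4.S36 (`isOrientedBordant_iff_signature_eq`) from Thom's Thm IV.13 alone**: bordism
invariance of the signature (Thm IV.1) is the theorem `signature_eq_of_isOrientedBordant_holds`;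
the only remaining input is the converse half `h₂ = isOrientedBordant_of_signature_eq` (`Ω⁴ ≅ ℤ`,
detected by the signature; Thom 1954, Thm IV.13).  PROVED.
[cite: ThomCMH1954, Thm IV.1 (p. 65) and Thm IV.13 (p. 81)] -/
theorem isOrientedBordant_iff_signature_eq_of_thom (h₂ : isOrientedBordant_of_signature_eq.{u}) :
    isOrientedBordant_iff_signature_eq.{u} :=
  isOrientedBordant_iff_signature_eq_of signature_eq_of_isOrientedBordant_holds h₂

end SPC4

end Literature.Topology.FourManifolds

end
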